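import Summits.BirchSwinnertonDyer.BirchSwinnertonDyer.Theses.SemiOrdinaryEisensteinDescent
import Summits.BirchSwinnertonDyer.BirchSwinnertonDyer.Theorems.SemiOrdinaryEisensteinDescentWildKolyvaginUpperAtThreeOfThreePrimitives
import Summits.BirchSwinnertonDyer.BirchSwinnertonDyer.Theorems.SemiOrdinaryEisensteinDescentShaTwoCochainShell
import Summits.BirchSwinnertonDyer.BirchSwinnertonDyer.Theorems.SemiOrdinaryEisensteinDescentShaTwoCochainBridgeAssemblyCriterion
import Summits.BirchSwinnertonDyer.BirchSwinnertonDyer.Theorems.SemiOrdinaryEisensteinDescentShaTwoCochainClassReadout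
import HarnessLib

/-!
# Crux Ko `WildKolyvaginUpperAtThree` (stmt-BirchSwinnertonDyer-20480), line `birth` — SKELETON v5
# (v5: width seat bsd-wall-soed-p2-w2 g12 = lead-of-record lineage, 2026-08-28, after item 20191 `CasselsTateLevelInputsFact` CLOSED;
#  v4: proposed by w2 g2, REGISTERED by w2 g3, 2026-08-28)

v5 = v4 with the CASSELS–TATE conjunct of `stub_inputsPrim` RETIRED: `∀ K, casselsTate_levelInputs K` is a TREE THEOREM since
2026-08-28 (the CT-20191 Ш²-cochain bridge of the SOED Kolyvagin-column width seats w3 g7 / w4 g2 / w2 g11 / w5 g6–g7 / w3 g8: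
`ShaTwoCochainTheta.casselsTate_levelInputs_of_shaTwoCochainBridge`, file `Theorems/SemiOrdinaryEisensteinDescentShaTwoCochainCasselsTate.lean`,
closing item 20191 — Milne ADT I 4.10 (a) in cochain form for THE canonical local invariant maps + Thm. 6.13 + Gross §5 (5.1)
equivariance, all discharged in the kernel over cell bsd-schneider's class-field-theory apparatus). The print stub is now
**`stub_twoPrimitives` := Gross 1991 Prop. 3.7 (2) ∧ Gross 1991 §6 / GZ86 III (3.1) (`E⁰`)** — the two remaining published inputs of
the column, both `X₀(N)`-geometry (Eichler–Shimura congruence for CM points of higher conductor; cusps and CM points in the Néron model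
of `J₀(N)`), items 23091 / 24701, cite-only. Composition unchanged (p591367) with the CT argument supplied BY NAME. Research stub
`stub_sigma` (= J 20760 BY NAME) unchanged. After v5 the line's displayed debt is EXACTLY {J 20760 research; 23091, 24701 print}.
BSD is not proved by any of this; Cassels–Tate / Poitou–Tate are published theorems discharged in the kernel.

# (v4 header, w2 g2 / w2 g3, 2026-08-28)

v4 = v3 with the `kolyvagin` conjunct of `stub_inputsPrim` DROPPED: Kolyvagin's Thm. A was used only for
`rank E(K) = 1` and `#Ш(E/K) < ∞` inside kmc g17's receptacle; on the cell the rank is a KERNEL theorem modulo the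
other two primitives (`KolyvaginRankOneOfGross1991E0Prop37.mordellWeilRank_eq_one_of_gross1991E0_of_frobeniusCongruence`,
p590255: x11b3's point-level END at `M = 1` → `Gross1991_kolyvaginClasses`; Gross Prop. 8.2 from the PROVED Poitou–Tate
reciprocity, `GrossProp82OfPoitouTate.gross1991_prop_8_2_holds`, p589739 → Prop. 2.1 → rank one with Serre PROVED) and the
finiteness of `Ш` is not needed (`ord₃ #Ш ≤ ord₃ #Ш[3^∞]` holds for `shaOrder = Nat.card Ш` unconditionally). Composition =
`WildKolyvaginUpperAtThreeOfThreePrimitives.wildKolyvaginUpperAtThree_of_sigma_of_threePrimitives` (p591367).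

w2 g3 ADDENDUM (2026-08-28, kernel p594241 / p594519, memo `TOWER-IDLE-w2g3.md` in this directory): the crux's `TowerSurjThree`
binder is IDLE on this road — the tree's derivation of McCallum's Cor. 5.6 (upper half) consumes only `ρ̄_{E,3}` onto (McCallum
1991 §3 itself assumes only `Gal(ℚ(E_p)/ℚ) = GL₂(ℤ/p)`): `WildKolyvaginUpperAtThreeTowerFree.koTowerFree_of_sigmaTowerFree_of_threePrimitives`
gives Ko-minus-tower from J-minus-tower + the same three primitives, and the route kernel re-runs tower-free
(`EisensteinKernelAtThreeTowerFree.wAllExclAddWildRankOneSurj_of_koTowerFree`), absorbing the residual crux NT (stmt-20484).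
The stubs below are unchanged by this (they are keyed to the items AS TYPED); a v5 for a restated tower-free Ko′/J′ is the
pen's call. The v3 text below is kept for the record.

# (v3 header, lead prover bsd-wall-soed-p2 g2, 2026-08-27)

v3 = v2 RESHAPED on both stubs (lead soed-p2 g2), same composition idea (Ko ⟸ research divisibility + Kolyvagin's
structure theorem, upper half):

* RESEARCH stub: v2's `stub_minftyGeManin` (Σ-form refined Kolyvagin ≥-half, Manin-robust, at the additive prime `3`, in
  CLASS currency `AdditiveThree.MinftyGe`) is REPLACED by **`stub_sigma` := the route's child J
  `Theses.SemiOrdinaryEisensteinDescent.WildSigmaDivisibilityAtThree` (stmt-BirchSwinnertonDyer-20760) BY NAME** — the SAME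
  open mathematics in POINT currency (`Koly.PDiv`: every derived Heegner point `P_n` over Zhang–Kolyvagin primes of index
  `≥ s′` is `3^{s′}`-divisible in `E(K[n])` for every `s′ ≤ ord₃ ∏ c_ℓ + v₃ c(Dt)`), which is formally WEAKER than the class
  stub (CLASS ⟹ POINT is lead g0's unconditional `WildKolyvaginUpperAtThreeOfMinftyGe.pDiv_of_minftyGe`, p567352; POINT ⟹ CLASS
  at a fixed level is not formal) and is exactly what the composition consumes. J has its own registered line `jetchev-max`
  (utd-p3 g3/g4: `stub_jetchevMaxAtThree` print-closed mod {PT, F1, 3.7} by p570933; `stub_beyondMax` research = Büyükboduk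
  2009 §4.2 Q1 + the Manin shadow). The v2 class stub remains a SUFFICIENT alternative
  (`WildKolyvaginUpperAtThreeOfPrimitives.wildKolyvaginUpperAtThree_of_minftyGeManin_of_primitives`).
* PRINT stub: v2's `stub_inputs` (= item 20761: Kolyvagin Thm. A ∧ Matar–Nekovář 2019 Thm. 0.7 read through §0.11 — flags
  `MN19-0.11-structure-composite`, `Kolyvagin1991-ThmCD-primary-unread`; the crux text's own worry «McCallum's structure
  theorem at p = 3 with 27 ∣ N is flagged unverified in the tree») is REPLACED by **`stub_inputsPrim` := the literal
  conjunction of four PRIMITIVE named facts** — (i) Kolyvagin 1990 Thm. A `∀ N W K, kolyvagin N W K` (rank one; the only use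
  is `[E(K) : ℤP] < ∞`), (ii) `casselsTate_levelInputs K` for every number field (Milne ADT I §6 + local CFT), (iii) Gross 1991
  Prop. 3.7 (2) image-free (`GrossLMS1991.prop37_2_frobeniusCongruence`, Eichler–Shimura for Heegner points of higher
  conductor), (iv) Gross 1991 §6 / GZ86 III (3.1) (`Gross1991_heegnerPoint_sub_ratTorsion_mem_E0`). The structure theorem
  itself (McCallum 1991 Cor. 5.6, upper half under global divisibility, `p`-adic tower image, NO reduction binder) is now a
  KERNEL THEOREM of the tree from (ii)–(iv): cell `bsd-stepL`'s
  `McCallum1991_padicValNat_card_sha_primary_add_le_of_globalDivisibility_of_casselsTate_of_frobeniusCongruence_of_E0`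
  (`Theorems/ClassRecordThreeKolyvaginShaOrderDivisibleEnd.lean`, 2026-08-27, over x11b3-p2's Kolyvagin descent mod `p^M`
  with Čebotarev / Weil / Serre / Poitou–Tate PROVED), consumed under the crux's OWN binder `TowerSurjThree` through width
  seat w2's McCallum road (`Theorems/SemiOrdinaryEisensteinDescentWildKolyvaginUpperAtThreeOfMcCallum.lean`, 2026-08-27).
  So the McCallum-at-`27 ∣ N` worry of the crux text is ANSWERED IN THE KERNEL and no Matar–Nekovář reading is used.

Composition `WildKolyvaginUpperAtThree_of` = w2's `wildKolyvaginUpperAtThree_of_sigma_of_mcCallum` fed with bsd-stepL's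
derivation (= lead g2's `WildKolyvaginUpperAtThreeOfPrimitives.wildKolyvaginUpperAtThree_of_sigma_of_primInputs`, p581112,
inlined here so that this file elaborates against the tree before that helper lands); it concludes the crux BY NAME; the only
sorries are the two stubs. History: v1 (pss3 g4 5f1807e9 / lead g0 155850bc) {stub_structure, stub_minftyGeManin,
stub_minftyFinite [LANDED p566353]}; v2 (lead g0 a85220ea) {stub_minftyGeManin, stub_inputs = 20761}. BSD is not proved by
any of this; Ko, J and the refined Kolyvagin conjecture at `3` stay open.
-/

set_option autoImplicit false
set_option linter.dupNamespace false -- `Summit.BirchSwinnertonDyer.BirchSwinnertonDyer.…` is the tree's layout (D-0017)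

noncomputable section

open scoped Classical

namespace Summit.BirchSwinnertonDyer.BirchSwinnertonDyer.Cruxes.WildKolyvaginUpperAtThree.Birth

open WeierstrassCurve NumberField Literature.NumberTheory.EllipticCurves
  Literature.NumberTheory.EllipticCurves.ModularForms
  Summit.BirchSwinnertonDyer.Rank1Residual
  Summit.BirchSwinnertonDyer.Rank1Residual.Additive
  Summit.BirchSwinnertonDyer.BirchSwinnertonDyer.Theorems

/-! ## §1 The two stubs -/

/-- STUB `stub_sigma` (v3) — THE RESEARCH INPUT = the route's child crux J `WildSigmaDivisibilityAtThree`
(stmt-BirchSwinnertonDyer-20760) BY NAME: Σ-form global divisibility of the derived Heegner points at the ADDITIVE prime `3`,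
Manin-robust, point currency — on Ko's binders verbatim (`ClassO6 W 3`, `ρ̄₃` onto with the `3`-adic tower, `r_an = 1`,
`K` Heegner for `N` with `d_K` odd `≠ −3`, `L(E^{d_K},1) ≠ 0`, `P = y_K` of infinite order on the frame `(Dt, H, ι)`), for
every `s′ ≤ ord₃ ∏_ℓ c_ℓ(E) + v₃(c(Dt))` and every Kolyvagin–Heegner datum `d` of square-free conductor over Zhang–Kolyvagin
primes of index `≥ s′`: `Koly.PDiv d 3 s′`. Jetchev 2008 Conj. 1.3 / W. Zhang's refined Kolyvagin conjecture, ≥-half; in print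
only the MAX-form at `p ∤ N` (Jetchev Thm. 1.4; at `3 ∣ N` kernel-closed mod {PT, F1, 3.7} by utd-p3's p570933) and the
Σ-form at good ordinary `p > 3` via the IMC (BCGS Thm. 2); the Σ − max gap is Büyükboduk 2009 §4.2 Q1 (open; no
local-condition method can supply it, w3's NOGO-STRINGENT-SCALING), and the Manin slack `v₃ c(Dt)` carries the `3`-part of
Manin's conjecture for the optimal curve (lead g2, MANIN-SHADOW memo). OPEN. [cite: Jetchev2008, Conj. 1.3 and Thm. 1.4 (p. 812)]
[cite: BurungaleEtAl2026, Thm. 2] -/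
theorem stub_sigma :
    Summit.BirchSwinnertonDyer.BirchSwinnertonDyer.Theses.SemiOrdinaryEisensteinDescent.WildSigmaDivisibilityAtThree := by
  sorry

/-- STUB `stub_twoPrimitives` (v5; replaces v4's `stub_inputsPrim` = CT ∧ 3.7 (2) ∧ E0, whose conjunct CT is the tree theorem
`ShaTwoCochainTheta.casselsTate_levelInputs_of_shaTwoCochainBridge` since item 20191 closed). THE TWO REMAINING PUBLISHED INPUTS BY NAME:
(iii) Gross 1991 Prop. 3.7 (2) in Nekovář's image-free rendering (`GrossLMS1991.prop37_2_frobeniusCongruence`, item 23091: the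
Frobenius congruence `y_n ≡ Frob(λ_m) y_m (mod λ_n)` of the Heegner Euler system — Eichler–Shimura on `X₀(N)_{𝔽_ℓ}` for CM points of
conductor `n`); (iv) Gross 1991 §6 / Gross–Zagier 1986 III (3.1) (`Gross1991_heegnerPoint_sub_ratTorsion_mem_E0`, item 24701: Heegner
points of Kolyvagin conductor lie in `E⁰` at the places above `N` up to rational torsion — the cusp `∞` and the CM points in the Néron
model of `J₀(N)`). Both are Literature named facts (`def … : Prop`), cite-only, size XL each (no model of `X₀(N)` over `ℤ` in the tree);
this stub closes when they are discharged. v4's text (with the CT conjunct) follows from it and the CT theorem.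
[cite: GrossLMS1991, §3 Prop. 3.7 (2) (p. 240), §6 proof of Prop. 6.2 (1) (p. 245)] [cite: GrossZagier1986, III (3.1)]
[cite: Nekovar2007, Prop. 4.9, 4.13 (ii)] -/
theorem stub_twoPrimitives :
    Literature.NumberTheory.EllipticCurves.GrossLMS1991.prop37_2_frobeniusCongruence ∧
      Literature.NumberTheory.EllipticCurves.Gross1991_heegnerPoint_sub_ratTorsion_mem_E0 := by
  sorry

/-! ## §2 The composition: the crux BY NAME from the two stubs -/

/-- **Ko from the line's stubs (v5).** `WildKolyvaginUpperAtThreeOfThreePrimitives.wildKolyvaginUpperAtThree_of_sigma_of_threePrimitives`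
(p591367): J + {CT, 3.7 (2), E0} with CT := the tree theorem of item 20191 (CLOSED; the three-constant term of p648480's
`ShaTwoCochainTheta.casselsTate_levelInputs_of_shaTwoCochainBridge`, imported from its three route-independent modules) and
{3.7 (2), E0} := `stub_twoPrimitives`; no Kolyvagin Thm. A, no tower input beyond the crux's own binder. (v4: the same term with
`stub_inputsPrim.1` in the CT slot.) Sorry-free; the only sorries of the file are the two stubs; concludes the crux BY NAME. [folklore] -/
theorem WildKolyvaginUpperAtThree_of :
    Summit.BirchSwinnertonDyer.BirchSwinnertonDyer.Theses.SemiOrdinaryEisensteinDescent.WildKolyvaginUpperAtThree :=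
  WildKolyvaginUpperAtThreeOfThreePrimitives.wildKolyvaginUpperAtThree_of_sigma_of_threePrimitives stub_sigma
    (fun K _ _ => ShaTwoCochainTheta.casselsTate_levelInputs_of_readout_vanishing_flip K
      (ShaTwoCochainTheta.hbridge_of_readout_criterion K (ShaTwoCochain.classBarInv_readout_eq_zero_of_criterion K)))
    stub_twoPrimitives.1 stub_twoPrimitives.2

end Summit.BirchSwinnertonDyer.BirchSwinnertonDyer.Cruxes.WildKolyvaginUpperAtThree.Birth

end
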